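import Summits.SmoothPoincare4.SmoothPoincare4.Theorems.SullivanDualTargetStubLiouvilleCollarChart
import Summits.SmoothPoincare4.SmoothPoincare4.Theorems.SullivanDualTargetStubLiouvilleCollarForms
import Literature.Geometry.Symplectic.GromovR4StdModel
import Literature.Geometry.Kaehler.ManifoldFormsPullback
import Literature.Geometry.Symplectic.SphereOpenBookForm

/-!
# Chart transport for the Liouville collar: the `1`-form `α` read in the chart

Helper file of stub `stub_liouvilleCollar` (line `kaehler-jacket`, crux stmt-SmoothPoincare4-7823).
For a smooth `1`-form `α` on `M ∖ p` (the tree's `MForm`, `IsSmoothForm`, `mextDeriv`) and a chart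
section `σ : ℝ⁴ → M ∖ p` over the ball `B` (file `…CollarChart`), the pulled-back form
`σ^*α` is a form on the model space `ℝ⁴`; read as a map `a : ℝ⁴ → (ℝ⁴ →L ℝ)`,
`a_y(w) = α_{σ y}(dσ_y w)`, it is `C^∞` on `B` and its antisymmetrised derivative is the exterior
derivative of `α`:
`Da_y(v)(w) − Da_y(w)(v) = dα_{σ y}(dσ_y v, dσ_y w)` (`helper_kjChartForm`) — Mathlib's
normalisation of `extDeriv` (`extDeriv_apply`), naturality of `d` under pull-back
(`mextDeriv_pullback_apply`, Warner 2.23) and `mextDeriv = extDeriv` on the model space.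

## References

* F. W. Warner, *Foundations of Differentiable Manifolds and Lie Groups*, GTM 94 (1983),
  2.22–2.23. [Warner1983]
-/

noncomputable section

set_option linter.dupNamespace false

open scoped Manifold ContDiff Topology
open Set Function Metric
open Literature.Geometry.Kaehler (MForm IsSmoothForm mextDeriv mextDeriv_eq_extDeriv
  mextDeriv_pullback_apply)
open Literature.Geometry.Symplectic (punctured)
open Literature.Topology.FourManifolds (HomotopySphere)

namespace Summit.SmoothPoincare4.SmoothPoincare4.Theorems.Target.KaehlerJacket

/-- Model space `ℝ⁴ = ℂ²`. -/
local notation "E4" => EuclideanSpace ℝ (Fin 4)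

/-! ### Forms on the model space -/

-- adapted from Literature/Geometry/Symplectic/SphereOpenBookForm.lean (`smoothAt_flat_of_contDiff`)
/-- In the flat case smoothness of a form at a point is `ContDiffAt`. [folklore] -/
theorem contDiffAt_of_smoothAt_E4 {k : ℕ} {β : E4 → E4 [⋀^Fin k]→L[ℝ] ℝ} {z : E4}
    (h : MForm.SmoothAt (I := 𝓘(ℝ, E4)) β z) : ContDiffAt ℝ ∞ β z := by
  rw [MForm.SmoothAt, Literature.Geometry.Symplectic.SphereOpenBook.inChart_eq_self_flat] at h
  simp only [modelWithCornersSelf_coe, range_id, extChartAt_self_apply] at h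
  exact h.contDiffAt Filter.univ_mem

/-- `Fin.removeNth 0 ![v, w] = ![w]`. [folklore] -/
theorem removeNth_zero_vec2 (v w : E4) : Fin.removeNth 0 ![v, w] = ![w] := by
  funext j
  fin_cases j
  rfl

/-- `Fin.removeNth 1 ![v, w] = ![v]`. [folklore] -/
theorem removeNth_one_vec2 (v w : E4) : Fin.removeNth 1 ![v, w] = ![v] := by
  funext j
  fin_cases j
  rfl

/-- **Mathlib's exterior derivative of a `1`-form on `ℝ⁴`, evaluated**:
`dβ_z(v, w) = D(β(·)(w))_z v − D(β(·)(v))_z w`. [folklore] -/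
theorem extDeriv_one_apply {β : E4 → E4 [⋀^Fin 1]→L[ℝ] ℝ} {z : E4}
    (h : DifferentiableAt ℝ β z) (v w : E4) :
    extDeriv β z ![v, w] =
      fderiv ℝ (fun y => β y ![w]) z v - fderiv ℝ (fun y => β y ![v]) z w := by
  rw [extDeriv_apply h, Fin.sum_univ_two, removeNth_zero_vec2, removeNth_one_vec2]
  simp only [Fin.val_zero, pow_zero, one_smul, Fin.val_one, pow_one, neg_smul,
    Matrix.cons_val_zero, Matrix.cons_val_one, Matrix.cons_val_fin_one]
  rw [sub_eq_add_neg]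

/-! ### The pulled-back `1`-form read as an operator-valued map -/

section General

variable {M : Type*} [TopologicalSpace M] [T2Space M] [ChartedSpace E4 M]
  [IsManifold (𝓡 4) ∞ M] {p q : M} {μ' : ℝ} {σ : E4 → punctured p}
  {α : MForm (𝓡 4) (punctured p) ℝ 1} {a : E4 → E4 →L[ℝ] ℝ}

/-- **The form `α` in the chart** (`a_y(w) = (σ^*α)_y(w)`): on the ball `B` it is `C^∞`,
evaluates as `α_{σ y}(dσ_y w)`, and its antisymmetrised derivative is `dα_{σ y}` on
`(dσ_y v, dσ_y w)`. [cite: Warner1983, 2.23] -/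
theorem chartForm_spec
    (hball : closedBall (extChartAt (𝓡 4) q q) μ' ⊆ (extChartAt (𝓡 4) q).target)
    (hσ : ∀ y ∈ ball (extChartAt (𝓡 4) q q) μ', (σ y).1 = (extChartAt (𝓡 4) q).symm y)
    (hα : IsSmoothForm α) (ha : ∀ y w, a y w = α.pullback 𝓘(ℝ, E4) σ y ![w])
    {y : E4} (hy : y ∈ ball (extChartAt (𝓡 4) q q) μ') :
    ContDiffAt ℝ ∞ a y ∧
    (∀ w : E4, a y w = α (σ y) ![mfderiv 𝓘(ℝ, E4) (𝓡 4) σ y w]) ∧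
    (∀ v w : E4, fderiv ℝ a y v w - fderiv ℝ a y w v =
      mextDeriv α (σ y) ![mfderiv 𝓘(ℝ, E4) (𝓡 4) σ y v, mfderiv 𝓘(ℝ, E4) (𝓡 4) σ y w]) := by
  set αb : E4 → E4 [⋀^Fin 1]→L[ℝ] ℝ := fun y => α.pullback 𝓘(ℝ, E4) σ y with hαb
  have hαb' : α.pullback 𝓘(ℝ, E4) σ = αb := rfl
  -- `σ` is smooth near `y`
  have hσev : ∀ᶠ z in 𝓝 y, ContMDiffAt 𝓘(ℝ, E4) (𝓡 4) ∞ σ z :=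
    Filter.eventually_of_mem (isOpen_ball.mem_nhds hy) fun z hz =>
      (chartSection_basic hball hσ hz).1
  have hsm : MForm.SmoothAt (I := 𝓘(ℝ, E4)) αb y := MForm.SmoothAt.pullback hσev (hα (σ y))
  have hαbd : ContDiffAt ℝ ∞ αb y := contDiffAt_of_smoothAt_E4 hsm
  -- `a = ofSubsingleton.symm ∘ αb`
  have haeq : a = fun y =>
      (ContinuousAlternatingMap.ofSubsingletonLIE (𝕜 := ℝ) (E := E4) (F := ℝ) (0 : Fin 1)).symm
        (αb y) := by
    funext y'
    ext w
    rw [ha, hαb']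
    show αb y' ![w] = (ContinuousAlternatingMap.ofSubsingleton ℝ E4 ℝ (0 : Fin 1)).symm (αb y') w
    rw [ContinuousAlternatingMap.ofSubsingleton_symm_apply_apply]
    congr 1
    funext i
    fin_cases i
    rfl
  have had : ContDiffAt ℝ ∞ a y := by
    rw [haeq]
    exact (ContinuousAlternatingMap.ofSubsingletonLIE (𝕜 := ℝ) (E := E4) (F := ℝ)
      (0 : Fin 1)).symm.contDiff.contDiffAt.comp y hαbd
  refine ⟨had, fun w => ?_, fun v w => ?_⟩
  · rw [ha, MForm.pullback_apply]
    congr 1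
    funext i
    fin_cases i
    rfl
  · -- antisymmetrised derivative = `extDeriv αb`
    have h1 : ∀ u : E4, (fun y' => a y' u) = fun y' => αb y' ![u] := fun u =>
      funext fun y' => ha y' u
    have h2 : ∀ u u' : E4, fderiv ℝ a y u' u = fderiv ℝ (fun y' => αb y' ![u]) y u' := by
      intro u u'
      rw [← h1 u, (hasFDerivAt_apply_const (had.differentiableAt (by simp)) u).fderiv,
        ContinuousLinearMap.flip_apply]
    rw [h2, h2, ← extDeriv_one_apply (hαbd.differentiableAt (by simp)), ← mextDeriv_eq_extDeriv]
    show mextDeriv (α.pullback 𝓘(ℝ, E4) σ) y ![v, w] = _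
    rw [mextDeriv_pullback_apply hσev (hα (σ y)), MForm.pullback_apply]
    congr 1
    funext i
    fin_cases i <;> rfl

end General

/-- **The `1`-form `α` in the chart** (`helper_kjChartForm`): for the carrier of a homotopy
`4`-sphere, a smooth `1`-form `α` on `Σ ∖ p`, a chart section `σ` over the ball `B`, and
`a_y(w) = (σ^*α)_y(w)`: on `B`, `a` is `C^∞`, `a_y(w) = α_{σ y}(dσ_y w)`, and
`Da_y(v)(w) − Da_y(w)(v) = dα_{σ y}(dσ_y v, dσ_y w)`. [cite: Warner1983, 2.23] -/
theorem helper_kjChartForm :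
    ∀ (S : HomotopySphere 4) (p q : S.carrier) (μ' : ℝ) (σ : E4 → punctured p)
      (α : MForm (𝓡 4) (punctured p) ℝ 1) (a : E4 → E4 →L[ℝ] ℝ),
      Metric.closedBall (extChartAt (𝓡 4) q q) μ' ⊆ (extChartAt (𝓡 4) q).target →
      (∀ y ∈ Metric.ball (extChartAt (𝓡 4) q q) μ', (σ y).1 = (extChartAt (𝓡 4) q).symm y) →
      IsSmoothForm α → (∀ y w, a y w = α.pullback 𝓘(ℝ, E4) σ y ![w]) →
      ∀ y ∈ Metric.ball (extChartAt (𝓡 4) q q) μ',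
        ContDiffAt ℝ ∞ a y ∧
        (∀ w : E4, a y w = α (σ y) ![mfderiv 𝓘(ℝ, E4) (𝓡 4) σ y w]) ∧
        (∀ v w : E4, fderiv ℝ a y v w - fderiv ℝ a y w v =
          mextDeriv α (σ y) ![mfderiv 𝓘(ℝ, E4) (𝓡 4) σ y v, mfderiv 𝓘(ℝ, E4) (𝓡 4) σ y w]) := by
  intro S p q μ' σ α a hball hσ hα ha y hy
  exact chartForm_spec hball hσ hα ha hy

end Summit.SmoothPoincare4.SmoothPoincare4.Theorems.Target.KaehlerJacket

end
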